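import Summits.AnomalousDissipation.AnomalousDissipation.Theses.ImpulseGrid
import Summits.AnomalousDissipation.AnomalousDissipation.Theses.Correlation
import Summits.AnomalousDissipation.AnomalousDissipation.Theorems.ImpulseGridGridThesisGlue
import Summits.AnomalousDissipation.AnomalousDissipation.Theorems.ImpulseGridBoundedEnergyNoLeakGridOfRegularDriftStates
import Summits.AnomalousDissipation.AnomalousDissipation.Theorems.ImpulseGridBoundedEnergyNoLeakGridOfNoMeanLeakage
import HarnessLib

/-!
# Route ImpulseGrid's target `GridThesis` from drift-state conjectures and the grid sign law:
# the two candidate RESPLITS of `GridThesis`, glued (crux stmt-AnomalousDissipation-14350, line `Sketch`)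

Support file for the crux `Summit.AnomalousDissipation.AnomalousDissipation.Theses.ImpulseGrid.BoundedEnergyNoLeakGrid`
(item stmt-AnomalousDissipation-14350, route route-AnomalousDissipation-ImpulseGrid).

Context.  Route ImpulseGrid's target `GridThesis` (stmt-1770) is split (D-0019 glued split, glue item stmt-14351,
`Theorems.gridThesisGlue_proof`) into the EXISTENCE side `BoundedEnergyNoLeakGrid` (stmt-14350: for every grid design,
vanishing-viscosity global Leray–Hopf families with drift datum, per-`j` cap, `j`-uniform mean energy, no Leray–Hopf
leakage in the mean) and the SIGN LAW `GridSignsLaw` (stmt-14349).  Five line leads (c0–c4) reduced stmt-14350, sorry-free,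
to registered residual stubs that are open problems AS FILED:

* `RegularDriftStates` (skeleton v4, stub `stub_regularDriftStatesExist`): for every grid design, `ν_j → 0⁺` and ETERNAL
  CLASSICAL solutions forced by `Φ • G` with drift datum `c e₀`, per-`j` forward cap and `j`-uniform mean energy — one
  existence conjecture about bounded regular drift states (an unstable exact coherent state per `ν_j` suffices), which
  pays for "no leakage" with regularity (`Theorems.boundedEnergyNoLeakGrid_of_regularDriftStates`, p109901); at the
  admissible design `Φ ≡ 1` it is the fixed-force `ν`-uniform energy problem and implies Correlation's `[open-problem]`
  items `BoundedEnergyEqualityZM` / `BoundedEnergyFamilyZM` (p109808);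
* `UEDF` (skeleton v5, stub `stub_uniformEnergyDriftFamilies`): the same at the Leray–Hopf level without regularity —
  NECESSARY for stmt-14350 (p110786) — which closes stmt-14350 together with Correlation's universal no-leakage crux
  `Correlation.NoMeanLeakage` (stmt-14265) (`Theorems.boundedEnergyNoLeakGrid_of_noMeanLeakage_of_uedf`, p120437).

Because stmt-14350 is already a second-layer item, neither residual can become a third-layer item (D-0019: at most two
layers).  The planner's legal move is a RESPLIT of `GridThesis` itself; this file lands the glue of BOTH candidate
resplits, so that either is born with its glue proved:

* `gridThesis_of_regularDriftStates` : `RegularDriftStates → GridSignsLaw → GridThesis`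
  (resplit A: children RegularDriftStates [new, conjecture-grade], GridSignsLaw [stmt-14349]);
* `gridThesis_of_noMeanLeakage_of_uedf` : `Correlation.NoMeanLeakage → UEDF → GridSignsLaw → GridThesis`
  (resplit B: children UEDF [new, conjecture-grade], NoMeanLeakage [= Correlation's stmt-14265, shared decl],
  GridSignsLaw [stmt-14349]).

Both are pure compositions of landed theorems; no definitions, no named facts, standard axioms.  The hypotheses are
written out verbatim from the registered stub signatures (no new `def`).

References: C. Foias, O. Manley, R. Rosa, R. Temam, *Navier–Stokes Equations and Turbulence* (CUP 2001), p. 71 and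
(13.11); C. R. Doering, C. Foias, J. Fluid Mech. 467 (2002) §3 (laminar `Re ~ Gr` versus turbulent `Re ~ Gr^{1/2}`).
-/

-- `Summit.<Summit>.<Problem>` is the tree's mandated summit-side namespace (CONVENTIONS §2); for this
-- single-conjunct summit the two coincide, so the duplicate is deliberate.
set_option linter.dupNamespace false

noncomputable section

open MeasureTheory Filter Set
open Literature.Analysis.FunctionSpaces Literature.Analysis.FunctionSpaces.Torus
open Literature.Analysis.FluidPDE Literature.Analysis.FluidPDE.Torus
open Summit.AnomalousDissipation.AnomalousDissipation.Theses
open Summit.AnomalousDissipation.AnomalousDissipation.Theses.ImpulseGrid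

namespace Summit.AnomalousDissipation.AnomalousDissipation.Theorems

/-- **Resplit A, glued**: bounded-mean-energy REGULAR drift families for every grid design (`RegularDriftStates`,
the registered residual of skeleton v4 of crux stmt-AnomalousDissipation-14350, written out) and the grid sign law
`GridSignsLaw` (stmt-AnomalousDissipation-14349) give route ImpulseGrid's target `GridThesis` (stmt-AnomalousDissipation-1770):
`gridThesisGlue_proof ∘ boundedEnergyNoLeakGrid_of_regularDriftStates`. [folklore] -/
theorem gridThesis_of_regularDriftStates :
    (∀ (Φ : UnitAddTorus (Fin 3) → ℝ) (G : UnitAddTorus (Fin 3) → EuclideanSpace ℝ (Fin 3)) (c : ℝ),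
      IsSmooth Φ → IsSmooth G →
      (∀ (s : UnitAddCircle) x, Φ (x + Pi.single (1 : Fin 3) s) = Φ x ∧ Φ (x + Pi.single (2 : Fin 3) s) = Φ x) →
      (∫ x, Φ x = 1) → (∀ (s : UnitAddCircle) x, G (x + Pi.single (0 : Fin 3) s) = G x) → (∀ x, G x 0 = 0) →
      IsSmooth (fun x => Φ x • G x) → IsDivFree (fun x => Φ x • G x) → HasZeroMean (fun x => Φ x • G x) →
      0 < c →
      ∃ (ν : ℕ → ℝ) (u : ℕ → ℝ → UnitAddTorus (Fin 3) → EuclideanSpace ℝ (Fin 3))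
          (p : ℕ → ℝ → UnitAddTorus (Fin 3) → ℝ),
        (∀ j, 0 < ν j) ∧ Tendsto ν atTop (nhds 0) ∧
        (∀ j, IsClassicalNSSolutionOn Set.univ (ν j) (fun _ => fun x => Φ x • G x) (u j) (p j)) ∧
        (∀ j, ∫ x, u j 0 x = c • EuclideanSpace.single (0 : Fin 3) (1 : ℝ)) ∧
        (∀ j, ∃ C : ℝ, ∀ t : ℝ, 0 ≤ t → kineticEnergy (u j t) ≤ C) ∧
        (∃ E : ℝ, ∀ j, meanEnergy (u j) ≤ E)) →
    Summit.AnomalousDissipation.AnomalousDissipation.Theses.ImpulseGrid.GridSignsLaw →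
    Summit.AnomalousDissipation.AnomalousDissipation.Theses.ImpulseGrid.GridThesis :=
  fun hR => gridThesisGlue_proof (boundedEnergyNoLeakGrid_of_regularDriftStates hR)

/-- **Resplit B, glued**: mean energy equality for Leray–Hopf solutions (`Correlation.NoMeanLeakage`,
stmt-AnomalousDissipation-14265), uniform-energy drift families for every grid design (UEDF, the registered residual
`stub_uniformEnergyDriftFamilies` of skeleton v5 of crux stmt-AnomalousDissipation-14350, written out) and the grid sign
law `GridSignsLaw` (stmt-AnomalousDissipation-14349) give `GridThesis` (stmt-AnomalousDissipation-1770):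
`gridThesisGlue_proof ∘ boundedEnergyNoLeakGrid_of_noMeanLeakage_of_uedf`. [folklore] -/
theorem gridThesis_of_noMeanLeakage_of_uedf :
    Summit.AnomalousDissipation.AnomalousDissipation.Theses.Correlation.NoMeanLeakage →
    (∀ (Φ : UnitAddTorus (Fin 3) → ℝ) (G : UnitAddTorus (Fin 3) → EuclideanSpace ℝ (Fin 3)) (c : ℝ),
      IsSmooth Φ → IsSmooth G →
      (∀ (s : UnitAddCircle) x, Φ (x + Pi.single (1 : Fin 3) s) = Φ x ∧ Φ (x + Pi.single (2 : Fin 3) s) = Φ x) →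
      (∫ x, Φ x = 1) → (∀ (s : UnitAddCircle) x, G (x + Pi.single (0 : Fin 3) s) = G x) → (∀ x, G x 0 = 0) →
      IsSmooth (fun x => Φ x • G x) → IsDivFree (fun x => Φ x • G x) → HasZeroMean (fun x => Φ x • G x) →
      0 < c →
      ∃ (ν : ℕ → ℝ) (u₀ : ℕ → UnitAddTorus (Fin 3) → EuclideanSpace ℝ (Fin 3))
          (u : ℕ → ℝ → UnitAddTorus (Fin 3) → EuclideanSpace ℝ (Fin 3)),
        (∀ j, 0 < ν j) ∧ Filter.Tendsto ν Filter.atTop (nhds 0) ∧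
        (∀ j, IsGlobalLerayHopf (ν j) (fun _ => fun x => Φ x • G x) (u₀ j) (u j)) ∧
        (∀ j, ∫ x, u₀ j x = c • EuclideanSpace.single 0 1) ∧
        (∃ E : ℝ, ∀ j, meanEnergy (u j) ≤ E)) →
    Summit.AnomalousDissipation.AnomalousDissipation.Theses.ImpulseGrid.GridSignsLaw →
    Summit.AnomalousDissipation.AnomalousDissipation.Theses.ImpulseGrid.GridThesis :=
  fun hNL hU => gridThesisGlue_proof (boundedEnergyNoLeakGrid_of_noMeanLeakage_of_uedf hNL hU)

end Summit.AnomalousDissipation.AnomalousDissipation.Theorems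

end
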